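import Mathlib.MeasureTheory.Measure.Haar.InnerProductSpace
import Literature.Topology.FourManifolds.KnotFraming
import Literature.Topology.FourManifolds.SliceRibbon
import HarnessLib

/-!
# A normal framing of a smooth surface in `ℝ⁴` along a strip (general position)

Topic `Literature/Topology/FourManifolds` (trunk T-4MAN); a brick of the decomposition of the
Fox–Milnor congruence `Literature.Topology.FourManifolds.Knot.IsConnectedSum.isConcordant`
(`BandSum.lean`, `BandSumConcordance.lean`), on the branch "a small copy of the second factor
carried along a concordance of the first factor inside a thin tube of a vertical strip of the
concordance annulus". Such a tube needs a `C^∞` normal framing of the annulus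
`F : ℝ × ℝ → ℝ⁴` (the lift `Literature.Topology.FourManifolds.StripFrame.annulusLift f` of a
concordance `f : 𝕊 1 × ℝ → ℝ⁴`, `Knot.IsConcordance`) along a strip `[θ₀ - η, θ₀ + η] × [a, b]`.
The normal bundle of the whole annulus need not be trivialised; along a strip a framing is
produced by **general position**, everything proved:

* `Literature.Topology.FourManifolds.StripFrame.exists_forall_fderiv_ne` — for a `C^∞` map
  `F : ℝ × ℝ → ℝ⁴` and a parameter `θ₀` there is a vector `w ∈ ℝ⁴` off all the tangent planes
  `DF(θ₀, t)(ℝ²)`, `t ∈ ℝ`: their union is the image of the hyperplane `{p₃ = 0} ⊆ ℝ⁴` under the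
  differentiable map `p ↦ DF(θ₀, p₀)(p₁, p₂)`, hence Lebesgue-null (the trivial case of Sard's
  theorem, Mathlib `addHaar_image_eq_zero_of_differentiableOn_of_addHaar_eq_zero`; Hirsch (1976),
  Ch. 3 §1, Prop. 1.2) — the argument of `exists_forall_smul_ne` (`KnotFraming.lean`) one
  dimension up;
* `Literature.Topology.FourManifolds.StripFrame.normalPart`, `….frame₁` — the normal part of
  `w` with respect to `(∂_θ F, ∂_t F)`, cleared of the Gram denominator so as to be a polynomial
  (`D • w - (c ⟪w, u⟫ - b ⟪w, v⟫) • u - (a ⟪w, v⟫ - b ⟪w, u⟫) • v`), nonzero at immersion points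
  where `w` is off the tangent plane (`frame₁_ne_zero`);
* `Literature.Topology.FourManifolds.StripFrame.triCross`, `….frame₂` — the **triple cross
  product** of `ℝ⁴` (`⟪triCross u v w, z⟫ = det (u, v, w, z)`, written out by cofactors) and
  Lagrange's identity `‖triCross u v w‖² = Gram (u, v, w)` (`inner_triCross_self`, by `ring`),
  whence the second normal field `frame₂ = triCross (∂_θ F) (∂_t F) frame₁`, orthogonal to the
  tangent plane and to `frame₁` and nonzero where `frame₁` is (`frame₂_ne_zero`: for a normal `w`
  the Gram determinant factors as `‖w‖² (a c - b²)`) — Kirby's "rotation by a right angle" in the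
  oriented normal plane (cf. `TwoKnotNormalSection.lean` for 2-knots in `S⁴`);
* `Literature.Topology.FourManifolds.StripFrame.eq_zero_of_combination_eq_zero` —
  `(∂_θ F, ∂_t F, frame₁, frame₂)` is a basis of `ℝ⁴` at such points;
* `Literature.Topology.FourManifolds.StripFrame.exists_frame_strip` — if `F` is an immersion along
  the arc `{θ₀} × [a, b]` then for suitable `w` and `η > 0` the frame is defined (immersion,
  `frame₁ ≠ 0`) on the whole strip `[θ₀ - η, θ₀ + η] × [a, b]` (continuity, compactness,
  `generalized_tube_lemma`);
* the lift `annulusLift f (θ, t) = f (circlePt θ, t)`: smoothness (`contDiff_annulusLift`), its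
  partial derivatives as images under `Df` of `(d circlePt 1, 0)` and `(0, 1)`
  (`dθ_annulusLift`, `dt_annulusLift`), and **the lift of an immersion is an immersion**
  (`injective_fderiv_annulusLift`, `Knot.IsConcordance.injective_fderiv_annulusLift`).

## References

* M. W. Hirsch, *Differential Topology*, GTM 33, Springer (1976), Ch. 3 §1, Prop. 1.2 (images of
  lower-dimensional manifolds are null); Ch. 4 §2 and §5 (normal bundles, tubular
  neighbourhoods). [HirschDT1976]
* R. C. Kirby, *The Topology of 4-Manifolds*, LNM 1374 (1989), Ch. VIII, proof of Thm. 2 (an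
  oriented 2-plane bundle with a nowhere-zero section is trivial). [Kirby1989]
* R. H. Fox, J. W. Milnor, *Singularities of 2-spheres in 4-space and cobordism of knots*, Osaka
  J. Math. 3 (1966), §1 (the consumer). [FoxMilnor1966]

## Design notes

* Everything is stated for a bare `C^∞` map `F : ℝ × ℝ → ℝ⁴` with `fderiv`; the passage from a
  concordance `f` on the manifold `𝕊 1 × ℝ` is confined to the last section (`annulusLift`, via
  the `1`-periodic covering `circlePt` of `TorusCoordinates.lean` and its local sections,
  `KnotFraming.lean`).
* No named facts, no `sorry`, no new notions beyond the auxiliary `triCross`, `gram₃`,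
  `normalPart`, `dθ`, `dt`, `gramD`, `frame₁`, `frame₂`, `annulusLift` (all in the namespace
  `Literature.Topology.FourManifolds.StripFrame`). Notation `𝔼 n`, `𝕊 n` is local,
  byte-identical to `Knots.lean`.
-/

open scoped Manifold ContDiff Topology RealInnerProductSpace
open Function Set MeasureTheory

noncomputable section

namespace Literature.Topology.FourManifolds

/-- Local notation: `𝔼 n` is the model Euclidean space `EuclideanSpace ℝ (Fin n)`. -/
local notation "𝔼 " n:arg => EuclideanSpace ℝ (Fin n)

/-- Local notation: `𝕊 n` is the unit sphere in `EuclideanSpace ℝ (Fin (n + 1))`. -/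
local notation "𝕊 " n:arg => (Metric.sphere (0 : EuclideanSpace ℝ (Fin (n + 1))) 1)

namespace StripFrame

/-! ### The triple cross product of `ℝ⁴` -/

/-- The **triple cross product** of `ℝ⁴`: `triCross u v w` is the vector with
`⟪triCross u v w, z⟫ = det (u, v, w, z)` (cofactor expansion along the last row), the Hodge dual
of `u ∧ v ∧ w`. It is orthogonal to `u`, `v`, `w`, and `‖triCross u v w‖²` is the Gram determinant
of `(u, v, w)` (Lagrange's identity), so it completes a linearly independent triple to a basis.
[folklore] -/
def triCross (u v w : 𝔼 4) : 𝔼 4 :=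
  WithLp.toLp 2
    ![-(u 1 * v 2 * w 3 - u 1 * v 3 * w 2 - u 2 * v 1 * w 3 + u 2 * v 3 * w 1
        + u 3 * v 1 * w 2 - u 3 * v 2 * w 1),
      u 0 * v 2 * w 3 - u 0 * v 3 * w 2 - u 2 * v 0 * w 3 + u 2 * v 3 * w 0
        + u 3 * v 0 * w 2 - u 3 * v 2 * w 0,
      -(u 0 * v 1 * w 3 - u 0 * v 3 * w 1 - u 1 * v 0 * w 3 + u 1 * v 3 * w 0
        + u 3 * v 0 * w 1 - u 3 * v 1 * w 0),
      u 0 * v 1 * w 2 - u 0 * v 2 * w 1 - u 1 * v 0 * w 2 + u 1 * v 2 * w 0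
        + u 2 * v 0 * w 1 - u 2 * v 1 * w 0]

/-- The **Gram determinant** of three vectors of `ℝ⁴`. [folklore] -/
def gram₃ (u v w : 𝔼 4) : ℝ :=
  ⟪u, u⟫ * (⟪v, v⟫ * ⟪w, w⟫ - ⟪v, w⟫ * ⟪v, w⟫)
    - ⟪u, v⟫ * (⟪u, v⟫ * ⟪w, w⟫ - ⟪v, w⟫ * ⟪u, w⟫)
    + ⟪u, w⟫ * (⟪u, v⟫ * ⟪v, w⟫ - ⟪v, v⟫ * ⟪u, w⟫)

section TriCross

variable (u v w : 𝔼 4)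

/-- Component `0` of the triple cross product. [folklore] -/
@[simp] theorem triCross_apply_zero : triCross u v w 0 =
    -(u 1 * v 2 * w 3 - u 1 * v 3 * w 2 - u 2 * v 1 * w 3 + u 2 * v 3 * w 1
      + u 3 * v 1 * w 2 - u 3 * v 2 * w 1) := rfl
/-- Component `1` of the triple cross product. [folklore] -/
@[simp] theorem triCross_apply_one : triCross u v w 1 =
    u 0 * v 2 * w 3 - u 0 * v 3 * w 2 - u 2 * v 0 * w 3 + u 2 * v 3 * w 0
      + u 3 * v 0 * w 2 - u 3 * v 2 * w 0 := rfl
/-- Component `2` of the triple cross product. [folklore] -/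
@[simp] theorem triCross_apply_two : triCross u v w 2 =
    -(u 0 * v 1 * w 3 - u 0 * v 3 * w 1 - u 1 * v 0 * w 3 + u 1 * v 3 * w 0
      + u 3 * v 0 * w 1 - u 3 * v 1 * w 0) := rfl
/-- Component `3` of the triple cross product. [folklore] -/
@[simp] theorem triCross_apply_three : triCross u v w 3 =
    u 0 * v 1 * w 2 - u 0 * v 2 * w 1 - u 1 * v 0 * w 2 + u 1 * v 2 * w 0
      + u 2 * v 0 * w 1 - u 2 * v 1 * w 0 := rfl

/-- `triCross u v w ⊥ u`. [folklore] -/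
theorem inner_triCross_left : ⟪triCross u v w, u⟫ = 0 := by
  rw [inner_fin_four]; simp; ring

/-- `triCross u v w ⊥ v`. [folklore] -/
theorem inner_triCross_middle : ⟪triCross u v w, v⟫ = 0 := by
  rw [inner_fin_four]; simp; ring

/-- `triCross u v w ⊥ w`. [folklore] -/
theorem inner_triCross_right : ⟪triCross u v w, w⟫ = 0 := by
  rw [inner_fin_four]; simp; ring

/-- **Lagrange's identity**: `‖triCross u v w‖²` is the Gram determinant of `(u, v, w)`. [folklore] -/
theorem inner_triCross_self : ⟪triCross u v w, triCross u v w⟫ = gram₃ u v w := by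
  rw [inner_fin_four, triCross_apply_zero, triCross_apply_one, triCross_apply_two,
    triCross_apply_three]
  simp only [gram₃, inner_fin_four]
  ring

/-- If `w` is orthogonal to `u` and `v`, the Gram determinant factors:
`gram₃ u v w = ‖w‖² (‖u‖² ‖v‖² - ⟪u, v⟫²)`. [folklore] -/
theorem gram₃_of_orthogonal (hu : ⟪u, w⟫ = 0) (hv : ⟪v, w⟫ = 0) :
    gram₃ u v w = ⟪w, w⟫ * (⟪u, u⟫ * ⟪v, v⟫ - ⟪u, v⟫ * ⟪u, v⟫) := by
  simp only [gram₃, hu, hv]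
  ring

/-- **The triple cross product of an independent pair and a nonzero common normal is nonzero.**
[folklore] -/
theorem triCross_ne_zero (hu : ⟪u, w⟫ = 0) (hv : ⟪v, w⟫ = 0) (hw : w ≠ 0)
    (hD : ⟪u, u⟫ * ⟪v, v⟫ - ⟪u, v⟫ * ⟪u, v⟫ ≠ 0) : triCross u v w ≠ 0 := by
  intro h
  have h1 : ⟪triCross u v w, triCross u v w⟫ = 0 := by rw [h, inner_zero_left]
  rw [inner_triCross_self, gram₃_of_orthogonal u v w hu hv] at h1
  rcases mul_eq_zero.1 h1 with h2 | h2
  · exact hw (inner_self_eq_zero.1 h2)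
  · exact hD h2

end TriCross

/-- The triple cross product of `C^∞` fields is `C^∞` (its components are polynomials in the
components). [folklore] -/
theorem contDiff_triCross {X : Type*} [NormedAddCommGroup X] [NormedSpace ℝ X]
    {u v w : X → 𝔼 4} (hu : ContDiff ℝ ∞ u) (hv : ContDiff ℝ ∞ v) (hw : ContDiff ℝ ∞ w) :
    ContDiff ℝ ∞ fun x ↦ triCross (u x) (v x) (w x) := by
  rw [contDiff_euclidean]
  have cu : ∀ i, ContDiff ℝ ∞ fun x ↦ u x i := contDiff_euclidean.1 hu
  have cv : ∀ i, ContDiff ℝ ∞ fun x ↦ v x i := contDiff_euclidean.1 hv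
  have cw : ∀ i, ContDiff ℝ ∞ fun x ↦ w x i := contDiff_euclidean.1 hw
  -- a monomial `u_i v_j w_k` is smooth
  have m : ∀ i j k, ContDiff ℝ ∞ fun x ↦ u x i * v x j * w x k := fun i j k ↦
    ((cu i).mul (cv j)).mul (cw k)
  have c0 := ((((((m 1 2 3).sub (m 1 3 2)).sub (m 2 1 3)).add (m 2 3 1)).add (m 3 1 2)).sub
    (m 3 2 1)).neg
  have c1 := (((((m 0 2 3).sub (m 0 3 2)).sub (m 2 0 3)).add (m 2 3 0)).add (m 3 0 2)).sub
    (m 3 2 0)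
  have c2 := ((((((m 0 1 3).sub (m 0 3 1)).sub (m 1 0 3)).add (m 1 3 0)).add (m 3 0 1)).sub
    (m 3 1 0)).neg
  have c3 := (((((m 0 1 2).sub (m 0 2 1)).sub (m 1 0 2)).add (m 1 2 0)).add (m 2 0 1)).sub
    (m 2 1 0)
  intro i
  fin_cases i
  · exact c0
  · exact c1
  · exact c2
  · exact c3

/-! ### The normal part of a vector with respect to a pair -/

/-- The **normal part** of `w` with respect to the pair `(u, v)`, cleared of denominators:
`normalPart u v w = D • w - (c ⟪w, u⟫ - b ⟪w, v⟫) • u - (a ⟪w, v⟫ - b ⟪w, u⟫) • v` with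
`a = ⟪u, u⟫`, `b = ⟪u, v⟫`, `c = ⟪v, v⟫`, `D = a c - b²`; for independent `u, v` this is `D`
times the orthogonal projection of `w` to `{u, v}ᗮ`, and it is a polynomial in `u, v, w` (hence
smooth along smooth fields, with no division). [folklore] -/
def normalPart (u v w : 𝔼 4) : 𝔼 4 :=
  (⟪u, u⟫ * ⟪v, v⟫ - ⟪u, v⟫ * ⟪u, v⟫) • w - (⟪v, v⟫ * ⟪w, u⟫ - ⟪u, v⟫ * ⟪w, v⟫) • u
    - (⟪u, u⟫ * ⟪w, v⟫ - ⟪u, v⟫ * ⟪w, u⟫) • v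

section NormalPart

variable (u v w : 𝔼 4)

/-- `normalPart u v w ⊥ u`. [folklore] -/
theorem inner_normalPart_left : ⟪normalPart u v w, u⟫ = 0 := by
  simp only [normalPart, inner_sub_left, inner_smul_left, RCLike.conj_to_real]
  rw [real_inner_comm v u]
  ring

/-- `normalPart u v w ⊥ v`. [folklore] -/
theorem inner_normalPart_right : ⟪normalPart u v w, v⟫ = 0 := by
  simp only [normalPart, inner_sub_left, inner_smul_left, RCLike.conj_to_real]
  rw [real_inner_self_eq_norm_sq v, real_inner_comm v u]
  ring

/-- If the normal part vanishes and `(u, v)` is independent (`D ≠ 0`), then `w` is a combination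
of `u` and `v`. [folklore] -/
theorem exists_eq_add_of_normalPart_eq_zero (h : normalPart u v w = 0)
    (hD : ⟪u, u⟫ * ⟪v, v⟫ - ⟪u, v⟫ * ⟪u, v⟫ ≠ 0) : ∃ α β : ℝ, w = α • u + β • v := by
  refine ⟨(⟪v, v⟫ * ⟪w, u⟫ - ⟪u, v⟫ * ⟪w, v⟫) / (⟪u, u⟫ * ⟪v, v⟫ - ⟪u, v⟫ * ⟪u, v⟫),
    (⟪u, u⟫ * ⟪w, v⟫ - ⟪u, v⟫ * ⟪w, u⟫) / (⟪u, u⟫ * ⟪v, v⟫ - ⟪u, v⟫ * ⟪u, v⟫), ?_⟩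
  have h' : (⟪u, u⟫ * ⟪v, v⟫ - ⟪u, v⟫ * ⟪u, v⟫) • w =
      (⟪v, v⟫ * ⟪w, u⟫ - ⟪u, v⟫ * ⟪w, v⟫) • u + (⟪u, u⟫ * ⟪w, v⟫ - ⟪u, v⟫ * ⟪w, u⟫) • v := by
    have := h
    unfold normalPart at this
    rw [sub_sub, sub_eq_zero] at this
    exact this
  apply smul_right_injective (𝔼 4) hD
  simp only [smul_add, smul_smul, mul_div_cancel₀ _ hD]
  exact h'

end NormalPart

/-- The normal part of `C^∞` fields is `C^∞`. [folklore] -/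
theorem contDiff_normalPart {X : Type*} [NormedAddCommGroup X] [NormedSpace ℝ X]
    {u v w : X → 𝔼 4} (hu : ContDiff ℝ ∞ u) (hv : ContDiff ℝ ∞ v) (hw : ContDiff ℝ ∞ w) :
    ContDiff ℝ ∞ fun x ↦ normalPart (u x) (v x) (w x) := by
  unfold normalPart
  exact ((((hu.inner ℝ hu).mul (hv.inner ℝ hv)).sub ((hu.inner ℝ hv).mul (hu.inner ℝ hv))).smul
    hw).sub ((((hv.inner ℝ hv).mul (hw.inner ℝ hu)).sub ((hu.inner ℝ hv).mul (hw.inner ℝ hv))).smul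
    hu) |>.sub ((((hu.inner ℝ hu).mul (hw.inner ℝ hv)).sub ((hu.inner ℝ hv).mul (hw.inner ℝ hu))).smul
    hv)

/-! ### Partial derivatives of a surface `ℝ × ℝ → ℝ⁴` and the Gram determinant -/

section Surface

variable (F : ℝ × ℝ → 𝔼 4)

/-- The `θ`-derivative `∂F/∂θ (q) = DF(q) (1, 0)`. [folklore] -/
def dθ (q : ℝ × ℝ) : 𝔼 4 := fderiv ℝ F q (1, 0)

/-- The `t`-derivative `∂F/∂t (q) = DF(q) (0, 1)`. [folklore] -/
def dt (q : ℝ × ℝ) : 𝔼 4 := fderiv ℝ F q (0, 1)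

/-- The Gram determinant `‖∂_θ F‖² ‖∂_t F‖² - ⟪∂_θ F, ∂_t F⟫²` of the two partial derivatives.
[folklore] -/
def gramD (q : ℝ × ℝ) : ℝ :=
  ⟪dθ F q, dθ F q⟫ * ⟪dt F q, dt F q⟫ - ⟪dθ F q, dt F q⟫ * ⟪dθ F q, dt F q⟫

variable {F}

/-- `DF(q) (a, b) = a • ∂_θ F + b • ∂_t F`. [folklore] -/
theorem fderiv_apply_eq (q : ℝ × ℝ) (v : ℝ × ℝ) :
    fderiv ℝ F q v = v.1 • dθ F q + v.2 • dt F q := by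
  have : v = v.1 • ((1 : ℝ), (0 : ℝ)) + v.2 • ((0 : ℝ), (1 : ℝ)) := by
    ext <;> simp
  conv_lhs => rw [this]
  rw [map_add, map_smul, map_smul]
  rfl

/-- The partial derivatives of a `C^∞` surface are `C^∞`. [folklore] -/
theorem contDiff_dθ (hF : ContDiff ℝ ∞ F) : ContDiff ℝ ∞ (dθ F) :=
  (hF.fderiv_right (m := ∞) (by simp)).clm_apply contDiff_const

/-- The partial derivatives of a `C^∞` surface are `C^∞`. [folklore] -/
theorem contDiff_dt (hF : ContDiff ℝ ∞ F) : ContDiff ℝ ∞ (dt F) :=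
  (hF.fderiv_right (m := ∞) (by simp)).clm_apply contDiff_const

/-- The Gram determinant of a `C^∞` surface is `C^∞`. [folklore] -/
theorem contDiff_gramD (hF : ContDiff ℝ ∞ F) : ContDiff ℝ ∞ (gramD F) :=
  (((contDiff_dθ hF).inner ℝ (contDiff_dθ hF)).mul ((contDiff_dt hF).inner ℝ (contDiff_dt hF))).sub
    (((contDiff_dθ hF).inner ℝ (contDiff_dt hF)).mul ((contDiff_dθ hF).inner ℝ (contDiff_dt hF)))

/-- **An immersion point has nonzero Gram determinant**: if `DF(q)` is injective then
`‖∂_θ F‖² ‖∂_t F‖² - ⟪∂_θ F, ∂_t F⟫² ≠ 0` (the equality case of Cauchy–Schwarz: `D = 0` forces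
`c • ∂_θ F = b • ∂_t F` with `(c, -b) ≠ 0`, or `∂_t F = 0`). [folklore] -/
theorem gramD_ne_zero (q : ℝ × ℝ) (hinj : Injective (fderiv ℝ F q)) : gramD F q ≠ 0 := by
  intro hD
  set u := dθ F q
  set p := dt F q
  have hD' : ⟪u, u⟫ * ⟪p, p⟫ - ⟪u, p⟫ * ⟪u, p⟫ = 0 := hD
  -- `‖c • u - b • p‖² = c · D = 0` with `b = ⟪u, p⟫`, `c = ⟪p, p⟫`
  have hn : ⟪⟪p, p⟫ • u - ⟪u, p⟫ • p, ⟪p, p⟫ • u - ⟪u, p⟫ • p⟫ =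
      ⟪p, p⟫ * (⟪u, u⟫ * ⟪p, p⟫ - ⟪u, p⟫ * ⟪u, p⟫) := by
    simp only [inner_sub_left, inner_sub_right, inner_smul_left, inner_smul_right,
      RCLike.conj_to_real]
    rw [real_inner_comm p u]
    ring
  rw [hD', mul_zero] at hn
  have hzero : ⟪p, p⟫ • u - ⟪u, p⟫ • p = 0 := inner_self_eq_zero.1 hn
  by_cases hc : ⟪p, p⟫ = 0
  · -- then `∂_t F = 0`, contradicting injectivity at `(0, 1)`
    have hp : p = 0 := inner_self_eq_zero.1 hc
    have h01 : fderiv ℝ F q ((0 : ℝ), (1 : ℝ)) = fderiv ℝ F q 0 := by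
      rw [map_zero]
      exact hp
    have := hinj h01
    simp at this
  · have hv : fderiv ℝ F q (⟪p, p⟫, -⟪u, p⟫) = fderiv ℝ F q 0 := by
      rw [map_zero, fderiv_apply_eq, neg_smul, ← sub_eq_add_neg]
      exact hzero
    have := hinj hv
    simp only [Prod.mk_eq_zero] at this
    exact hc this.1

/-! ### General position: a vector off all tangent planes along an arc -/

/-- **General position.** For a `C^∞` surface `F : ℝ × ℝ → ℝ⁴` and a parameter `θ₀` there is a
vector `w ∈ ℝ⁴` which is not a tangent vector `DF(θ₀, t) v` at any point of the arc `θ = θ₀`: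
the set of such tangent vectors is the image of the hyperplane `{p₃ = 0} ⊆ ℝ⁴` under the
differentiable map `p ↦ DF(θ₀, p₀) (p₁, p₂)`, hence Lebesgue-null (the trivial case of Sard's
theorem, `MeasureTheory.addHaar_image_eq_zero_of_differentiableOn_of_addHaar_eq_zero`; Hirsch,
*Differential Topology* (1976), Ch. 3, §1, Prop. 1.2: the image of a manifold of smaller
dimension is nowhere dense). [folklore] -/
theorem exists_forall_fderiv_ne (hF : ContDiff ℝ ∞ F) (θ₀ : ℝ) :
    ∃ w : 𝔼 4, ∀ (t : ℝ) (v : ℝ × ℝ), fderiv ℝ F (θ₀, t) v ≠ w := by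
  let g : 𝔼 4 → 𝔼 4 := fun p ↦ fderiv ℝ F (θ₀, p 0) (p 1, p 2)
  let V : Submodule ℝ (𝔼 4) :=
    LinearMap.ker ((EuclideanSpace.proj (3 : Fin 4) : 𝔼 4 →L[ℝ] ℝ) : 𝔼 4 →ₗ[ℝ] ℝ)
  have hV : V ≠ ⊤ := by
    intro h
    have : (EuclideanSpace.single (3 : Fin 4) (1 : ℝ) : 𝔼 4) ∈ V := h ▸ Submodule.mem_top
    simp [V] at this
  have hV0 : volume (V : Set (𝔼 4)) = 0 := Measure.addHaar_submodule volume V hV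
  have hdF : Differentiable ℝ (fderiv ℝ F) :=
    (hF.fderiv_right (m := ∞) (by simp)).differentiable (by simp)
  have hg : DifferentiableOn ℝ g V := by
    refine Differentiable.differentiableOn ?_
    have hproj : ∀ i : Fin 4, Differentiable ℝ fun p : 𝔼 4 ↦ p i := fun i ↦
      differentiable_euclidean.1 differentiable_id i
    have h0 : Differentiable ℝ fun p : 𝔼 4 ↦ ((θ₀, p 0) : ℝ × ℝ) :=
      (differentiable_const θ₀).prodMk (hproj 0)
    have h12 : Differentiable ℝ fun p : 𝔼 4 ↦ ((p 1, p 2) : ℝ × ℝ) := (hproj 1).prodMk (hproj 2)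
    exact (hdF.comp h0).clm_apply h12
  have himg : volume (g '' V) = 0 :=
    addHaar_image_eq_zero_of_differentiableOn_of_addHaar_eq_zero volume hg hV0
  by_contra hcon
  push Not at hcon
  have hsub : (univ : Set (𝔼 4)) ⊆ g '' V := by
    intro w _
    obtain ⟨t, v, hw⟩ := hcon w
    refine ⟨WithLp.toLp 2 ![t, v.1, v.2, 0], ?_, ?_⟩
    · simp [V]
    · simpa [g] using hw
  have hle := measure_mono (μ := volume) hsub
  rw [himg, nonpos_iff_eq_zero] at hle
  exact isOpen_univ.measure_ne_zero volume univ_nonempty hle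

/-! ### The normal frame -/

/-- The **first normal field**: the normal part of the fixed vector `w` with respect to
`(∂_θ F, ∂_t F)`. [folklore] -/
def frame₁ (F : ℝ × ℝ → 𝔼 4) (w : 𝔼 4) (q : ℝ × ℝ) : 𝔼 4 :=
  normalPart (dθ F q) (dt F q) w

/-- The **second normal field**: the triple cross product of `∂_θ F`, `∂_t F` and the first
normal field (the first normal field "rotated by a right angle" in the oriented normal plane).
[folklore] -/
def frame₂ (F : ℝ × ℝ → 𝔼 4) (w : 𝔼 4) (q : ℝ × ℝ) : 𝔼 4 :=
  triCross (dθ F q) (dt F q) (frame₁ F w q)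

variable {w : 𝔼 4} {q : ℝ × ℝ}

/-- The first normal field is `C^∞`. [folklore] -/
theorem contDiff_frame₁ (hF : ContDiff ℝ ∞ F) (w : 𝔼 4) : ContDiff ℝ ∞ (frame₁ F w) :=
  contDiff_normalPart (contDiff_dθ hF) (contDiff_dt hF) contDiff_const

/-- The second normal field is `C^∞`. [folklore] -/
theorem contDiff_frame₂ (hF : ContDiff ℝ ∞ F) (w : 𝔼 4) : ContDiff ℝ ∞ (frame₂ F w) :=
  contDiff_triCross (contDiff_dθ hF) (contDiff_dt hF) (contDiff_frame₁ hF w)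

/-- `frame₁ ⊥ ∂_θ F`. [folklore] -/
theorem inner_frame₁_dθ (w : 𝔼 4) (q : ℝ × ℝ) : ⟪frame₁ F w q, dθ F q⟫ = 0 :=
  inner_normalPart_left _ _ _

/-- `frame₁ ⊥ ∂_t F`. [folklore] -/
theorem inner_frame₁_dt (w : 𝔼 4) (q : ℝ × ℝ) : ⟪frame₁ F w q, dt F q⟫ = 0 :=
  inner_normalPart_right _ _ _

/-- `frame₂ ⊥ ∂_θ F`. [folklore] -/
theorem inner_frame₂_dθ (w : 𝔼 4) (q : ℝ × ℝ) : ⟪frame₂ F w q, dθ F q⟫ = 0 :=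
  inner_triCross_left _ _ _

/-- `frame₂ ⊥ ∂_t F`. [folklore] -/
theorem inner_frame₂_dt (w : 𝔼 4) (q : ℝ × ℝ) : ⟪frame₂ F w q, dt F q⟫ = 0 :=
  inner_triCross_middle _ _ _

/-- `frame₂ ⊥ frame₁`. [folklore] -/
theorem inner_frame₂_frame₁ (w : 𝔼 4) (q : ℝ × ℝ) : ⟪frame₂ F w q, frame₁ F w q⟫ = 0 :=
  inner_triCross_right _ _ _

/-- **The first normal field does not vanish at an immersion point off whose tangent plane `w`
lies.** [folklore] -/
theorem frame₁_ne_zero (hD : gramD F q ≠ 0) (hw : ∀ v : ℝ × ℝ, fderiv ℝ F q v ≠ w) :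
    frame₁ F w q ≠ 0 := by
  intro h
  obtain ⟨α, β, hαβ⟩ := exists_eq_add_of_normalPart_eq_zero _ _ _ h hD
  refine hw (α, β) ?_
  rw [fderiv_apply_eq, hαβ]

/-- **The second normal field does not vanish where the first does not** (at an immersion
point). [folklore] -/
theorem frame₂_ne_zero (hD : gramD F q ≠ 0) (h₁ : frame₁ F w q ≠ 0) : frame₂ F w q ≠ 0 :=
  triCross_ne_zero _ _ _ (by rw [real_inner_comm]; exact inner_frame₁_dθ w q)
    (by rw [real_inner_comm]; exact inner_frame₁_dt w q) h₁ hD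

/-- **The frame is a frame**: at an immersion point where `frame₁ ≠ 0`, the four vectors
`∂_θ F, ∂_t F, frame₁, frame₂` are linearly independent, in the form: the linear map
`(a, b, c, d) ↦ a • ∂_θ F + b • ∂_t F + c • frame₁ + d • frame₂` has trivial kernel. [folklore] -/
theorem eq_zero_of_combination_eq_zero (hD : gramD F q ≠ 0) (h₁ : frame₁ F w q ≠ 0)
    {a b c d : ℝ}
    (h : a • dθ F q + b • dt F q + c • frame₁ F w q + d • frame₂ F w q = 0) :
    a = 0 ∧ b = 0 ∧ c = 0 ∧ d = 0 := by
  have h₂ : frame₂ F w q ≠ 0 := frame₂_ne_zero hD h₁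
  -- pair with `frame₂`: `d ‖frame₂‖² = 0`
  have hd : d = 0 := by
    have := congrArg (fun z ↦ ⟪frame₂ F w q, z⟫) h
    simp only [inner_add_right, inner_smul_right, inner_zero_right, inner_frame₂_dθ,
      inner_frame₂_dt, inner_frame₂_frame₁, mul_zero, zero_add] at this
    rcases mul_eq_zero.1 this with h' | h'
    · exact h'
    · exact absurd (inner_self_eq_zero.1 h') h₂
  subst hd
  -- pair with `frame₁`: `c ‖frame₁‖² = 0`
  have hc : c = 0 := by
    have := congrArg (fun z ↦ ⟪frame₁ F w q, z⟫) h
    simp only [inner_add_right, inner_smul_right, inner_zero_right, inner_frame₁_dθ,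
      inner_frame₁_dt, zero_smul, add_zero, mul_zero, zero_add] at this
    rcases mul_eq_zero.1 this with h' | h'
    · exact h'
    · exact absurd (inner_self_eq_zero.1 h') h₁
  subst hc
  -- the tangential part: `a • ∂_θ F + b • ∂_t F = 0` with `D ≠ 0`
  simp only [zero_smul, add_zero] at h
  have hu := congrArg (fun z ↦ ⟪dθ F q, z⟫) h
  have hv := congrArg (fun z ↦ ⟪dt F q, z⟫) h
  simp only [inner_add_right, inner_smul_right, inner_zero_right] at hu hv
  rw [real_inner_comm (dθ F q) (dt F q)] at hv
  -- Cramer: `D a = 0`, `D b = 0`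
  have ha : gramD F q * a = 0 := by
    unfold gramD
    linear_combination ⟪dt F q, dt F q⟫ * hu - ⟪dθ F q, dt F q⟫ * hv
  have hb : gramD F q * b = 0 := by
    unfold gramD
    linear_combination ⟪dθ F q, dθ F q⟫ * hv - ⟪dθ F q, dt F q⟫ * hu
  exact ⟨(mul_eq_zero.1 ha).resolve_left hD, (mul_eq_zero.1 hb).resolve_left hD, rfl, rfl⟩

/-! ### A uniform strip around the arc -/

/-- **A normal frame along a strip.** Let `F : ℝ × ℝ → ℝ⁴` be `C^∞` and an immersion at the
points `(θ₀, t)`, `t ∈ [a, b]`. Then there are a vector `w` and a width `η > 0` such that on the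
strip `[θ₀ - η, θ₀ + η] × [a, b]` the map `F` is an immersion and the first (hence also the
second) normal field of the frame `(frame₁ F w, frame₂ F w)` does not vanish: a `C^∞` normal
framing of the surface along the strip. (General position for `w`, then continuity and
compactness of `[a, b]`, `generalized_tube_lemma`.) [folklore] -/
theorem exists_frame_strip (hF : ContDiff ℝ ∞ F) (θ₀ : ℝ) {a b : ℝ}
    (hinj : ∀ t ∈ Icc a b, Injective (fderiv ℝ F (θ₀, t))) :
    ∃ w : 𝔼 4, ∃ η : ℝ, 0 < η ∧ ∀ q ∈ Icc (θ₀ - η) (θ₀ + η) ×ˢ Icc a b,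
      gramD F q ≠ 0 ∧ frame₁ F w q ≠ 0 := by
  obtain ⟨w, hw⟩ := exists_forall_fderiv_ne hF θ₀
  -- the good set is open and contains the arc
  set U : Set (ℝ × ℝ) := {q | gramD F q ≠ 0 ∧ frame₁ F w q ≠ 0} with hU_def
  have hUo : IsOpen U := by
    refine (isOpen_ne_fun (contDiff_gramD hF).continuous continuous_const).inter ?_
    exact isOpen_ne_fun (contDiff_frame₁ hF w).continuous continuous_const
  have harc : ({θ₀} : Set ℝ) ×ˢ Icc a b ⊆ U := by
    rintro ⟨θ, t⟩ ⟨hθ, ht⟩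
    rw [mem_singleton_iff] at hθ
    subst hθ
    have hD := gramD_ne_zero (θ, t) (hinj t ht)
    exact ⟨hD, frame₁_ne_zero hD (hw t)⟩
  obtain ⟨u, v, hu, -, hθu, htv, huv⟩ :=
    generalized_tube_lemma isCompact_singleton isCompact_Icc hUo harc
  obtain ⟨η, hη, hball⟩ := Metric.isOpen_iff.1 hu θ₀ (hθu (mem_singleton θ₀))
  refine ⟨w, η / 2, by positivity, ?_⟩
  rintro ⟨θ, t⟩ ⟨hθ, ht⟩
  have hθ' : θ ∈ u := hball (by
    rw [Metric.mem_ball, Real.dist_eq, abs_lt]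
    constructor <;> linarith [hθ.1, hθ.2])
  exact huv ⟨hθ', htv ht⟩

end Surface

/-! ### The lift of an annulus `𝕊 1 × ℝ → ℝ⁴` to the plane -/

/-- The **lift** `(θ, t) ↦ f (circlePt θ, t)` of a map on `𝕊 1 × ℝ` to `ℝ × ℝ`, `1`-periodic in
`θ` (`circlePt θ = (cos 2πθ, sin 2πθ)`, `TorusCoordinates.lean`). [folklore] -/
def annulusLift (f : (𝕊 1) × ℝ → 𝔼 4) (q : ℝ × ℝ) : 𝔼 4 :=
  f (circlePt q.1, q.2)

section Lift

variable {f : (𝕊 1) × ℝ → 𝔼 4}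

/-- Pointwise formula for the lift. [folklore] -/
@[simp]
theorem annulusLift_apply (f : (𝕊 1) × ℝ → 𝔼 4) (θ t : ℝ) :
    annulusLift f (θ, t) = f (circlePt θ, t) := rfl

/-- The lift is `1`-periodic in `θ`. [folklore] -/
theorem annulusLift_add_int (f : (𝕊 1) × ℝ → 𝔼 4) (θ t : ℝ) (m : ℤ) :
    annulusLift f (θ + m, t) = annulusLift f (θ, t) := by
  simp [annulusLift, circlePt_add_int]

/-- The parametrisation `(θ, t) ↦ (circlePt θ, t)` is `C^∞`. [folklore] -/
theorem contMDiff_circlePt_prod :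
    ContMDiff (𝓘(ℝ, ℝ).prod 𝓘(ℝ, ℝ)) ((𝓡 1).prod 𝓘(ℝ, ℝ)) ∞
      (fun q : ℝ × ℝ ↦ ((circlePt q.1, q.2) : (𝕊 1) × ℝ)) :=
  (contMDiff_circlePt.comp contMDiff_fst).prodMk contMDiff_snd

/-- The lift of a `C^∞` map is `C^∞` on `ℝ²`. [folklore] -/
theorem contDiff_annulusLift (hfs : ContMDiff ((𝓡 1).prod 𝓘(ℝ, ℝ)) 𝓘(ℝ, 𝔼 4) ∞ f) :
    ContDiff ℝ ∞ (annulusLift f) := by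
  rw [← contMDiff_iff_contDiff]
  have h := hfs.comp contMDiff_circlePt_prod
  rw [modelWithCornersSelf_prod, ← chartedSpaceSelf_prod]
  exact h

/-- The `θ`-derivative of the lift is the image under `Df` of the velocity of `circlePt`:
`∂_θ (annulusLift f) (θ, t) = Df(circlePt θ, t) (d(circlePt)(θ) 1, 0)`. [folklore] -/
theorem dθ_annulusLift (hfs : ContMDiff ((𝓡 1).prod 𝓘(ℝ, ℝ)) 𝓘(ℝ, 𝔼 4) ∞ f) (θ t : ℝ) :
    dθ (annulusLift f) (θ, t) =
      mfderiv ((𝓡 1).prod 𝓘(ℝ, ℝ)) 𝓘(ℝ, 𝔼 4) f (circlePt θ, t)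
        ((ContinuousLinearMap.inl ℝ _ _) (mfderiv 𝓘(ℝ, ℝ) (𝓡 1) circlePt θ (1 : ℝ))) := by
  have hn : (∞ : ℕ∞ω) ≠ 0 := by simp
  -- `∂_θ` is the derivative of the curve `θ ↦ annulusLift f (θ, t)`
  have h1 : dθ (annulusLift f) (θ, t) = deriv (fun s ↦ annulusLift f (s, t)) θ := by
    have hd : DifferentiableAt ℝ (annulusLift f) (θ, t) :=
      (contDiff_annulusLift hfs).contDiffAt.differentiableAt hn
    rw [← fderiv_apply_one_eq_deriv]
    rw [show (fun s ↦ annulusLift f (s, t)) = annulusLift f ∘ fun s ↦ (s, t) from rfl,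
      fderiv_comp θ hd ((differentiableAt_id).prodMk (differentiableAt_const t))]
    simp [dθ, (hasFDerivAt_prodMk_left θ t).fderiv]
  -- the curve is `f ∘ γ` with `γ s = (circlePt s, t)`
  set γ : ℝ → (𝕊 1) × ℝ := fun s ↦ (circlePt s, t) with hγ
  have hγs : ContMDiff 𝓘(ℝ, ℝ) ((𝓡 1).prod 𝓘(ℝ, ℝ)) ∞ γ :=
    contMDiff_circlePt.prodMk contMDiff_const
  have hγd : MDifferentiableAt 𝓘(ℝ, ℝ) ((𝓡 1).prod 𝓘(ℝ, ℝ)) γ θ := hγs.mdifferentiableAt hn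
  have hfd : MDifferentiableAt ((𝓡 1).prod 𝓘(ℝ, ℝ)) 𝓘(ℝ, 𝔼 4) f (γ θ) :=
    hfs.mdifferentiableAt hn
  have h2 : deriv (fun s ↦ annulusLift f (s, t)) θ =
      mfderiv 𝓘(ℝ, ℝ) 𝓘(ℝ, 𝔼 4) (f ∘ γ) θ (1 : ℝ) := by
    rw [← fderiv_apply_one_eq_deriv, ← mfderiv_eq_fderiv]
    rfl
  have hc : MDifferentiableAt 𝓘(ℝ, ℝ) (𝓡 1) circlePt θ :=
    contMDiff_circlePt.mdifferentiableAt hn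
  have hγ' : HasMFDerivAt 𝓘(ℝ, ℝ) ((𝓡 1).prod 𝓘(ℝ, ℝ)) γ θ
      ((mfderiv 𝓘(ℝ, ℝ) (𝓡 1) circlePt θ).prod
        (0 : TangentSpace 𝓘(ℝ, ℝ) θ →L[ℝ] TangentSpace 𝓘(ℝ, ℝ) t)) :=
    hc.hasMFDerivAt.prodMk (hasMFDerivAt_const t θ)
  rw [h1, h2, mfderiv_comp θ hfd hγd]
  show mfderiv ((𝓡 1).prod 𝓘(ℝ, ℝ)) 𝓘(ℝ, 𝔼 4) f (γ θ)
      (mfderiv 𝓘(ℝ, ℝ) ((𝓡 1).prod 𝓘(ℝ, ℝ)) γ θ (1 : ℝ)) = _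
  rw [hγ'.mfderiv]
  rfl

/-- The `t`-derivative of the lift: `∂_t (annulusLift f) (θ, t) = Df(circlePt θ, t) (0, 1)`.
[folklore] -/
theorem dt_annulusLift (hfs : ContMDiff ((𝓡 1).prod 𝓘(ℝ, ℝ)) 𝓘(ℝ, 𝔼 4) ∞ f) (θ t : ℝ) :
    dt (annulusLift f) (θ, t) =
      mfderiv ((𝓡 1).prod 𝓘(ℝ, ℝ)) 𝓘(ℝ, 𝔼 4) f (circlePt θ, t)
        ((ContinuousLinearMap.inr ℝ _ _) (1 : ℝ)) := by
  have hn : (∞ : ℕ∞ω) ≠ 0 := by simp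
  have h1 : dt (annulusLift f) (θ, t) = deriv (fun s ↦ annulusLift f (θ, s)) t := by
    have hd : DifferentiableAt ℝ (annulusLift f) (θ, t) :=
      (contDiff_annulusLift hfs).contDiffAt.differentiableAt hn
    rw [← fderiv_apply_one_eq_deriv]
    rw [show (fun s ↦ annulusLift f (θ, s)) = annulusLift f ∘ fun s ↦ (θ, s) from rfl,
      fderiv_comp t hd ((differentiableAt_const θ).prodMk differentiableAt_id)]
    simp [dt, (hasFDerivAt_prodMk_right θ t).fderiv]
  set γ : ℝ → (𝕊 1) × ℝ := fun s ↦ (circlePt θ, s) with hγ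
  have hγs : ContMDiff 𝓘(ℝ, ℝ) ((𝓡 1).prod 𝓘(ℝ, ℝ)) ∞ γ :=
    contMDiff_const.prodMk contMDiff_id
  have hγd : MDifferentiableAt 𝓘(ℝ, ℝ) ((𝓡 1).prod 𝓘(ℝ, ℝ)) γ t := hγs.mdifferentiableAt hn
  have hfd : MDifferentiableAt ((𝓡 1).prod 𝓘(ℝ, ℝ)) 𝓘(ℝ, 𝔼 4) f (γ t) :=
    hfs.mdifferentiableAt hn
  have h2 : deriv (fun s ↦ annulusLift f (θ, s)) t =
      mfderiv 𝓘(ℝ, ℝ) 𝓘(ℝ, 𝔼 4) (f ∘ γ) t (1 : ℝ) := by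
    rw [← fderiv_apply_one_eq_deriv, ← mfderiv_eq_fderiv]
    rfl
  have hγ' : HasMFDerivAt 𝓘(ℝ, ℝ) ((𝓡 1).prod 𝓘(ℝ, ℝ)) γ t
      ((0 : TangentSpace 𝓘(ℝ, ℝ) t →L[ℝ] TangentSpace (𝓡 1) (circlePt θ)).prod
        (ContinuousLinearMap.id ℝ (TangentSpace 𝓘(ℝ, ℝ) t))) :=
    (hasMFDerivAt_const (circlePt θ) t).prodMk (hasMFDerivAt_id t)
  rw [h1, h2, mfderiv_comp t hfd hγd]
  show mfderiv ((𝓡 1).prod 𝓘(ℝ, ℝ)) 𝓘(ℝ, 𝔼 4) f (γ t)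
      (mfderiv 𝓘(ℝ, ℝ) ((𝓡 1).prod 𝓘(ℝ, ℝ)) γ t (1 : ℝ)) = _
  rw [hγ'.mfderiv]
  rfl

/-- **The lift of an immersion is an immersion**: if `Df(circlePt θ, t)` is injective then so is
`D(annulusLift f)(θ, t)` (the columns `∂_θ`, `∂_t` are the images of the independent vectors
`(d circlePt 1, 0)`, `(0, 1)`; `d circlePt ≠ 0` by `mfderiv_circlePt_injective`). [folklore] -/
theorem injective_fderiv_annulusLift (hfs : ContMDiff ((𝓡 1).prod 𝓘(ℝ, ℝ)) 𝓘(ℝ, 𝔼 4) ∞ f)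
    {θ t : ℝ} (himm : Injective (mfderiv ((𝓡 1).prod 𝓘(ℝ, ℝ)) 𝓘(ℝ, 𝔼 4) f (circlePt θ, t))) :
    Injective (fderiv ℝ (annulusLift f) (θ, t)) := by
  refine (injective_iff_map_eq_zero _).2 fun v hv ↦ ?_
  set A := mfderiv ((𝓡 1).prod 𝓘(ℝ, ℝ)) 𝓘(ℝ, 𝔼 4) f (circlePt θ, t) with hA
  set c : EuclideanSpace ℝ (Fin 1) := mfderiv 𝓘(ℝ, ℝ) (𝓡 1) circlePt θ (1 : ℝ) with hc
  set e₁ : TangentSpace ((𝓡 1).prod 𝓘(ℝ, ℝ)) (circlePt θ, t) :=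
    (ContinuousLinearMap.inl ℝ _ _) c with he₁
  set e₂ : TangentSpace ((𝓡 1).prod 𝓘(ℝ, ℝ)) (circlePt θ, t) :=
    (ContinuousLinearMap.inr ℝ (TangentSpace (𝓡 1) (circlePt θ)) _) (1 : ℝ) with he₂
  rw [fderiv_apply_eq, dθ_annulusLift hfs, dt_annulusLift hfs] at hv
  have hτ : A (v.1 • e₁ + v.2 • e₂) = 0 := by
    have e : A (v.1 • e₁ + v.2 • e₂) = v.1 • A e₁ + v.2 • A e₂ := by
      simp only [map_add, map_smul]
    rw [e]
    exact hv
  have h0 : v.1 • e₁ + v.2 • e₂ = 0 := (injective_iff_map_eq_zero A).1 himm _ hτ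
  have hc0 : c ≠ (0 : EuclideanSpace ℝ (Fin 1)) := by
    intro h
    have h' : (1 : ℝ) = 0 :=
      (injective_iff_map_eq_zero _).1 (mfderiv_circlePt_injective θ) (1 : ℝ) h
    exact one_ne_zero h'
  -- read off the two components in the model space `ℝ¹ × ℝ` of the tangent space
  have h0' : v.1 • ((c, (0 : ℝ)) : EuclideanSpace ℝ (Fin 1) × ℝ) +
      v.2 • (((0 : EuclideanSpace ℝ (Fin 1)), (1 : ℝ)) : EuclideanSpace ℝ (Fin 1) × ℝ) = 0 := h0
  have h1 : v.1 • c = (0 : EuclideanSpace ℝ (Fin 1)) := by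
    have := congrArg Prod.fst h0'
    simpa using this
  have h2 : v.2 = 0 := by
    have := congrArg Prod.snd h0'
    simpa using this
  exact Prod.ext ((smul_eq_zero.1 h1).resolve_right hc0) h2

/-- For a concordance, the lift is an immersion on the closed annulus `t ∈ [1, 2]`. [folklore] -/
theorem _root_.Literature.Topology.FourManifolds.Knot.IsConcordance.injective_fderiv_annulusLift
    {K K' : Knot} (hf : Knot.IsConcordance K K' f) (θ : ℝ) {t : ℝ} (ht : t ∈ Icc (1 : ℝ) 2) :
    Injective (fderiv ℝ (annulusLift f) (θ, t)) :=
  StripFrame.injective_fderiv_annulusLift hf.1 (hf.2.2.1 (circlePt θ, t) ⟨mem_univ _, ht⟩)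

end Lift

end StripFrame

end Literature.Topology.FourManifolds
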